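import Summits.QuantumFields.YangMills.Theorems.BalabanUVNodesN08MassesACLeastClosedFamilyPrint

/-!
# BalabanUVNodes ∕ N08 — THE ONE-STEP EXCESS OVER HAAR IN DENSITY CURRENCY: `dU∘Ū⁻¹ − dV = (ρ − 1)₊·dV`, `ρ = d(Ū_*dU)∕dV` (= any version of `T1` of
# [Balaban1985Averaging] (10), a.e.) — the analytic target of files 17∕17b∕21b written as transported positive parts `(T_j 1 − 1)₊`

Track A, DAG node N08 = T. Bałaban, CMP **102** (1985) 255–275 [Balaban1985UV3]: (41) p. 266, (2) p. 256; the averaging (2) and its transformation = [Balaban1985Averaging]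
(15), (10) p. 19.  Cell `pub-ymgap`, width seat `pub-ymgap-dag-n08-w1` (g4), W-SEAT-START-LIST §n08 item 1 successor piece (o17) = file 22; `--supports` K1⁷
`StabilityBAtRecordR13SepCoPH` (helper).  Companion of files 17 (`…N08MassesACLeastClosedFamily`: the least weakly-closed family `ν♯`, its one-step bound `ν♯_{k+1} ≤
(dU_k∘Ū_k⁻¹ − dU_{k+1}) + ν♯_k∘Ū_k⁻¹`), 17b (print junction) and 21b (`PrintedUV3V` ⟸ (α)-AC rows ∧ a density bound on a weakly-closed family ∧ consts).

WHAT THIS FILE PROVES (kernel; theorems only, 0 def; [folklore] measure theory; nothing of the paper asserted).  For ANY averaging with `AvgAC` (measurable, `Ū_*(dU) ≪ dV`):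
* §1 ★★ `map_sub_eq_withDensity_rnDeriv_sub_one` — **`dU∘Ū⁻¹ − dV = dV.withDensity (ρ − 1)`, `ρ = d(Ū_*dU)∕dV`** (Mathlib's truncated subtractions on both sides: the excess
  measure IS the positive part of the density defect); `rnDeriv_map_ae_eq_T_one` — `ρ = T1` a.e. for EVERY Radon–Nikodym version `T : RTOpI` of (10)
  (`B10Eq2HaarCompatibility.map_avg_eq_withDensity_T_one`); `map_sub_univ_eq_lintegral` — its total mass `∫⁻ (ρ − 1) dV`; `map_sub_eq_zero_iff` — `= 0 ↔ ρ ≤ 1` a.e.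
  (↔ E6′, since both are probability measures: `B10Eq2HaarCompatibility.map_avg_eq_iff_T_one_ae_eq_one`).
* §2 ★ `excessRec_succ_le_withDensity` — file 17's one-step bound for the least family in density currency: `ν♯_{k+1} ≤ (ρ_k − 1)₊·dV + ν♯_k∘Ū_k⁻¹`; `weakClosed_of_posPartRec` ∕
  `excessRec_le_of_posPartRec` — the TRANSPORTED POSITIVE PARTS `μ_k = Σ_{j<k} (Ū_{k−1}∘⋯∘Ū_{j+1})_*[(ρ_j − 1)₊·dU_{j+1}]` form a weakly-closed family above `ν♯` — so the analytic
  target (a) reads: **bound, `dV_k`-a.e. by `e^{c|T₁^{(k)}|} − 1`, the density of that sum** (then file 21b's `…_of_weakClosed_of_consts'` gives the slot modulo the (α)-AC rows).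
* §3 at the [B10] slot's averaging `avOfPrint N S` (AvgAC by `avgAC_avOfPrint`; print's own version `TOfPrint N S j`): `map_sub_avOfPrint_eq_withDensity`,
  `rnDeriv_map_avOfPrint_ae_eq_TOfPrint_one`.

HONEST FRAMING: count-neutral helper; no density bound is claimed — (a) stays OPEN; E6′ NOT decided; N08 NOT discharged; one finite 𝕋⁴ programme at fixed ε, Bałaban AS
PRINTED — R4 closes the conditional finite-𝕋⁴ rung `BalabanLadder.UV` only; the Yang–Mills mass gap (Clay) is NOT proved by any of this; nothing continuum ∕ ℝ⁴ ∕ OS.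
No `sorry`, standard axioms.
-/

noncomputable section

open MeasureTheory
open scoped ENNReal

namespace Summit.QuantumFields.YangMills.BalabanUVNodes.N08OneStepExcessDensity

open Literature.MathematicalPhysics.QuantumFieldTheory.Balaban1983to89
open Literature.MathematicalPhysics.QuantumFieldTheory.Balaban1983to89.B10Eq2HaarCompatibility (map_avg_eq_withDensity_T_one aemeasurable_ofReal_T_one)
open Summit.QuantumFields.Balaban3D.Carriers
open Summit.QuantumFields.YangMills.BalabanUVNodes.N08MassesACLeastClosedFamily (excessRec_succ_le weakClosed_of_oneStepExcessRec excessRec_le_of_weakClosed)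

/-! ## §1 The one-step excess over Haar is the positive part of the density defect -/
section Generic

variable {P : Params} {j : ℕ} {G : Type*} [GaugeGroup G] [MeasurableSpace G] [HaarData G] {av : Averaging P j G}

/-- ★★ **`dU∘Ū⁻¹ − dV = dV.withDensity (ρ − 1)` with `ρ = d(Ū_*dU)∕dV`** for every averaging with `AvgAC`: write `Ū_*(dU) = ρ·dV` (absolute continuity,
`Measure.withDensity_rnDeriv_eq`), `dV = 1·dV`, and subtract densities (Mathlib `Measure.withDensity_sub`, truncated). [cite: Balaban1985Averaging, (10) + (15) p.19 (bookkeeping)] -/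
theorem map_sub_eq_withDensity_rnDeriv_sub_one (hav : AvgAC av.avg) :
    (fieldMeasure P j G).map av.avg - fieldMeasure P (j + 1) G =
      (fieldMeasure P (j + 1) G).withDensity (((fieldMeasure P j G).map av.avg).rnDeriv (fieldMeasure P (j + 1) G) - 1) := by
  haveI : IsFiniteMeasure ((fieldMeasure P (j + 1) G).withDensity (1 : GaugeField P (j + 1) G → ℝ≥0∞)) := by
    rw [withDensity_one]; infer_instance
  have h := Measure.withDensity_sub (μ := fieldMeasure P (j + 1) G) (f := ((fieldMeasure P j G).map av.avg).rnDeriv (fieldMeasure P (j + 1) G))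
    (g := (1 : GaugeField P (j + 1) G → ℝ≥0∞)) (Measure.measurable_rnDeriv _ _) measurable_const
  rw [Measure.withDensity_rnDeriv_eq _ _ hav.2, withDensity_one] at h
  exact h.symm

/-- **`ρ = T1` a.e. for every Radon–Nikodym version `T` of (10)** along the averaging (`Ū_*(dU) = (T1)·dV`, `B10Eq2HaarCompatibility.map_avg_eq_withDensity_T_one`, and
`rnDeriv_withDensity₀`). [cite: Balaban1985Averaging, (10) p.19 (bookkeeping)] -/
theorem rnDeriv_map_ae_eq_T_one (T : RTOpI P j G av) (havg : Measurable av.avg) :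
    ((fieldMeasure P j G).map av.avg).rnDeriv (fieldMeasure P (j + 1) G) =ᵐ[fieldMeasure P (j + 1) G] fun V => ENNReal.ofReal (T.T 1 V) := by
  rw [map_avg_eq_withDensity_T_one T havg]
  exact Measure.rnDeriv_withDensity₀ _ (aemeasurable_ofReal_T_one T).1

/-- **The total mass of the one-step excess is `∫⁻ (ρ − 1) dV`** (`≤ 1`: it is at most `Ū_*(dU)(univ) = 1`). [folklore] -/
theorem map_sub_univ_eq_lintegral (hav : AvgAC av.avg) :
    ((fieldMeasure P j G).map av.avg - fieldMeasure P (j + 1) G) Set.univ =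
      ∫⁻ V, (((fieldMeasure P j G).map av.avg).rnDeriv (fieldMeasure P (j + 1) G) - 1) V ∂(fieldMeasure P (j + 1) G) := by
  rw [map_sub_eq_withDensity_rnDeriv_sub_one hav, withDensity_apply _ MeasurableSet.univ, Measure.restrict_univ]

/-- The one-step excess has total mass `≤ 1`. [folklore] -/
theorem map_sub_univ_le_one (hav : AvgAC av.avg) : ((fieldMeasure P j G).map av.avg - fieldMeasure P (j + 1) G) Set.univ ≤ 1 := by
  calc ((fieldMeasure P j G).map av.avg - fieldMeasure P (j + 1) G) Set.univ ≤ (fieldMeasure P j G).map av.avg Set.univ := Measure.sub_le Set.univ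
    _ = 1 := by rw [Measure.map_apply hav.1 MeasurableSet.univ, Set.preimage_univ, measure_univ]

/-- **The one-step excess VANISHES iff `ρ ≤ 1` a.e.** (iff `Ū_*(dU) ≤ dV`, iff — both being probability measures — exact Haar compatibility E6′; cf.
`B10Eq2HaarCompatibility.map_avg_eq_iff_T_one_ae_eq_one`). [cite: Balaban1985Averaging, (13) + (15) p.19 (bookkeeping)] -/
theorem map_sub_eq_zero_iff (hav : AvgAC av.avg) :
    (fieldMeasure P j G).map av.avg - fieldMeasure P (j + 1) G = 0 ↔
      ∀ᵐ V ∂(fieldMeasure P (j + 1) G), ((fieldMeasure P j G).map av.avg).rnDeriv (fieldMeasure P (j + 1) G) V ≤ 1 := by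
  have hf : AEMeasurable (((fieldMeasure P j G).map av.avg).rnDeriv (fieldMeasure P (j + 1) G) - 1) (fieldMeasure P (j + 1) G) :=
    ((Measure.measurable_rnDeriv _ _).sub measurable_one).aemeasurable
  rw [map_sub_eq_withDensity_rnDeriv_sub_one hav, withDensity_eq_zero_iff hf]
  exact Filter.eventually_congr (Filter.Eventually.of_forall fun V => by simp [tsub_eq_zero_iff_le])

end Generic

/-! ## §2 The least family's one-step bound in density currency -/
section Least

variable {P : Params} {G : Type} [GaugeGroup G] [MeasurableSpace G] [HaarData G] {av : ∀ j, Averaging P j G}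
  (hav : ∀ j, AvgAC (av j).avg) (νs : ∀ k, Measure (GaugeField P k G)) (h0 : νs 0 = 0)
  (hsucc : ∀ k, νs (k + 1) = (fieldMeasure P k G + νs k).map (av k).avg - fieldMeasure P (k + 1) G)
include hav hsucc

/-- ★ **`ν♯_{k+1} ≤ (ρ_k − 1)₊·dV + ν♯_k∘Ū_k⁻¹`** — file 17's `excessRec_succ_le` with the one-step excess written as the positive part of the density defect
`ρ_k = d((Ū_k)_*dU_k)∕dV`.  Unrolled: `ν♯_k ≤ Σ_{j<k} (Ū_{k−1}∘⋯∘Ū_{j+1})_*[(ρ_j − 1)₊·dU_{j+1}]` — the analytic target (a) is a `dV_k`-a.e. bound `≤ e^{c|T₁^{(k)}|} − 1` on the density of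
THIS sum. [cite: Balaban1985UV3, (41) p.266; Balaban1985Averaging, (10) + (15) p.19 (bookkeeping)] -/
theorem excessRec_succ_le_withDensity (k : ℕ) :
    νs (k + 1) ≤ (fieldMeasure P (k + 1) G).withDensity (((fieldMeasure P k G).map (av k).avg).rnDeriv (fieldMeasure P (k + 1) G) - 1)
      + (νs k).map (av k).avg := by
  rw [← map_sub_eq_withDensity_rnDeriv_sub_one (hav k)]
  exact excessRec_succ_le νs hsucc (fun j => (hav j).1) k

omit h0 hsucc in
/-- ★ **THE TRANSPORTED POSITIVE PARTS FORM A WEAKLY-CLOSED FAMILY**: any family with `μ_{k+1} ≥ (ρ_k − 1)₊·dV + μ_k∘Ū_k⁻¹` (`k < K̄`) — e.g. WITH equality, `μ_k = Σ_{j<k}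
(Ū_{k−1}∘⋯∘Ū_{j+1})_*[(ρ_j − 1)₊·dU_{j+1}]` — is weakly closed (file 17 §4b with §1's identity); hence (file 17 §2∕§3, file 21b) a `dV_k`-a.e. density bound `≤ e^{c|T₁^{(k)}|} − 1` on it gives
the a.e. extensive mass bound and the slot of record modulo the (α)-AC rows. [cite: Balaban1985UV3, (41) p.266; Balaban1985Averaging, (10) + (15) p.19 (bookkeeping)] -/
theorem weakClosed_of_posPartRec (Kt : ℕ) (μ : ∀ k, Measure (GaugeField P k G))
    (hrec : ∀ k, k < Kt → (fieldMeasure P (k + 1) G).withDensity (((fieldMeasure P k G).map (av k).avg).rnDeriv (fieldMeasure P (k + 1) G) - 1)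
      + (μ k).map (av k).avg ≤ μ (k + 1)) :
    ∀ k, k < Kt → (fieldMeasure P k G + μ k).map (av k).avg ≤ fieldMeasure P (k + 1) G + μ (k + 1) :=
  weakClosed_of_oneStepExcessRec (fun j => (hav j).1) Kt μ fun k hk => by
    rw [map_sub_eq_withDensity_rnDeriv_sub_one (hav k)]; exact hrec k hk

include h0 in
/-- … and the least family `ν♯` lies below every such family (`k ≤ K̄`). [folklore] -/
theorem excessRec_le_of_posPartRec (Kt : ℕ) (μ : ∀ k, Measure (GaugeField P k G))
    (hrec : ∀ k, k < Kt → (fieldMeasure P (k + 1) G).withDensity (((fieldMeasure P k G).map (av k).avg).rnDeriv (fieldMeasure P (k + 1) G) - 1)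
      + (μ k).map (av k).avg ≤ μ (k + 1)) :
    ∀ k, k ≤ Kt → νs k ≤ μ k :=
  excessRec_le_of_weakClosed νs h0 hsucc (fun j => (hav j).1) Kt μ (weakClosed_of_posPartRec hav Kt μ hrec)

end Least

/-! ## §3 At the [B10] slot's averaging -/
section Print

open Literature.MathematicalPhysics.QuantumFieldTheory.Balaban1985CMP102.Setting (Scales)
open Literature.MathematicalPhysics.QuantumFieldTheory.Balaban1983to89.B10RunsOfRecord (avOfPrint TOfPrint)
open Literature.MathematicalPhysics.QuantumFieldTheory.Balaban1983to89.Node00 (SU)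
open Summit.QuantumFields.YangMills.BalabanUVNodes.N08Thm2AtRecordBridgeInhabited (avgAC_avOfPrint)

variable (N : ℕ) [NeZero N] {L : ℕ} (S : Scales L) (j : ℕ)

/-- **At print's averaging: `dU_j∘Ū_j⁻¹ − dU_{j+1} = (ρ_j − 1)₊·dU_{j+1}`, `ρ_j = d((avOfPrint)_*dU_j)∕dV`**, every level, every `N`. [cite: Balaban1985UV3, (2) p.256; Balaban1985Averaging, (15) p.19] -/
theorem map_sub_avOfPrint_eq_withDensity :
    (fieldMeasure S.P j (SU N)).map (avOfPrint N S j).avg - fieldMeasure S.P (j + 1) (SU N) =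
      (fieldMeasure S.P (j + 1) (SU N)).withDensity (((fieldMeasure S.P j (SU N)).map (avOfPrint N S j).avg).rnDeriv (fieldMeasure S.P (j + 1) (SU N)) - 1) :=
  map_sub_eq_withDensity_rnDeriv_sub_one (avgAC_avOfPrint N L S j)

/-- **… and `ρ_j = (TOfPrint N S j) 1` a.e.** — print's own Radon–Nikodym version of (10) along (15). [cite: Balaban1985UV3, (2) p.256; Balaban1985Averaging, (10) p.19] -/
theorem rnDeriv_map_avOfPrint_ae_eq_TOfPrint_one :
    ((fieldMeasure S.P j (SU N)).map (avOfPrint N S j).avg).rnDeriv (fieldMeasure S.P (j + 1) (SU N)) =ᵐ[fieldMeasure S.P (j + 1) (SU N)]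
      fun V => ENNReal.ofReal ((TOfPrint N S j).T 1 V) :=
  rnDeriv_map_ae_eq_T_one (TOfPrint N S j) (avgAC_avOfPrint N L S j).1

end Print

end Summit.QuantumFields.YangMills.BalabanUVNodes.N08OneStepExcessDensity

end
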